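import Literature.Analysis.Complex.RiemannSphereDbar
import Literature.Analysis.Complex.RiemannSphereTangentialSlice
import HarnessLib

/-!
# Level maps between the Hölder spaces of sections over the Riemann sphere

Topic `Literature/Analysis/Complex`. For the Hölder spaces `𝓗^{k,r}_τ(F)` of sections of the line
bundle with clutching function `τ` over `S² = ℂ_z ∪ ℂ_w`
(`Literature/Analysis/Complex/RiemannSphereHolderSections.lean`: pairs of pieces
`(g₀, g₁) ∈ C^{k,r}_b(ℂ, F)²` subject to the two piece relations) we record the inclusions between
LEVELS `k ≤ k'` and the fact that every construction of the two-chart calculus commutes with them —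
the piece relations, the chart representatives `sec₀`, `sec₁`, the cut-off representatives and the
point evaluations are conditions on / functions of the underlying functions only:

* `ContDiffHolderFunction.inclLE hr h : C^{k',r}_b(E, F) →L[ℝ] C^{k,r}_b(E, F)` (`h : k ≤ k'`,
  `r ≤ 1`; dot-notation extensions of `Literature/Analysis/FunctionSpaces/ContDiffHolderSpace.lean`
  declared with absolute names) — same underlying function (`MemContDiffHolder.of_le`, iterating
  `MemContDiffHolder.of_succ`), bounded by the closed graph theorem, injective, transitive, and
  `= inclCLM` for `k' = k + 1`;
* `RiemannSphere.inclLE hr h : 𝓗^{k',r}_τ →L[ℝ] 𝓗^{k,r}_τ` — the pair of the above on the pieces;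
  `sec₀_inclLE`, `sec₁_inclLE`, `cutSec₀CLM_inclLE`, `eval₀CLM_inclLE`, `slice₃_inclLE`, injectivity;
* the **level lift** `RiemannSphere.exists_inclLE_eq_of_memContDiffHolder`: a member of `𝓗^{k,r}_τ`
  whose two pieces are in `C^{k',r}_b` is the image of a (unique) member of `𝓗^{k',r}_τ`
  (`mem_range_inclLE_iff`); cf. the one-step lift `exists_inclCLM_eq_of_memContDiffHolder` of
  `RiemannSphereLocalRegularityLift.lean`.

This is the bookkeeping by which an implicit-function argument run in one Hölder level is compared
with the same argument in a higher level (Wendl 2018, proof of Thm. 2.46). Everything is proved; no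
named facts.

## References

* D. D. Joyce, *Riemannian Holonomy Groups and Calibrated Geometry* (2007), §1.2. [Joyce2007]
* C. Wendl, *Holomorphic Curves in Low Dimensions*, LNM 2216 (2018), §2.1.3, Thm. 2.46. [Wendl2018]
-/

noncomputable section

open Set Filter Metric Function
open scoped Topology NNReal ContDiff

namespace Literature.Analysis.Complex

namespace RiemannSphere

open Literature.Analysis.FunctionSpaces

/-! ### Level inclusions of `C^{k,r}_b(E, F)` -/

section Holder

variable {E F : Type*} [NormedAddCommGroup E] [NormedSpace ℝ E] [NormedAddCommGroup F]
  [NormedSpace ℝ F] {k k' k'' : ℕ} {r : ℝ≥0}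

/-- **Order reduction across several levels**: `C^{k',r}_b ⊆ C^{k,r}_b` for `k ≤ k'` and `r ≤ 1`
(iterate `MemContDiffHolder.of_succ`). A dot-notation extension of
`Literature.Analysis.FunctionSpaces.MemContDiffHolder` declared with its absolute name. [folklore] -/
theorem _root_.Literature.Analysis.FunctionSpaces.MemContDiffHolder.of_le (hr : r ≤ 1)
    (h : k ≤ k') {f : E → F} (hf : MemContDiffHolder k' r f) : MemContDiffHolder k r f := by
  induction h with
  | refl => exact hf
  | step _ ih => exact ih (hf.of_succ hr)

/-- The inclusion `C^{k',r}_b ⊆ C^{k,r}_b` (`k ≤ k'`, `r ≤ 1`) as a linear map (extension of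
`Literature.Analysis.FunctionSpaces.ContDiffHolderFunction`, absolute name). [folklore] -/
def _root_.Literature.Analysis.FunctionSpaces.ContDiffHolderFunction.inclLEₗ (hr : r ≤ 1)
    (h : k ≤ k') : ContDiffHolderFunction E F k' r →ₗ[ℝ] ContDiffHolderFunction E F k r where
  toFun u := ⟨u, u.memContDiffHolder.of_le hr h⟩
  map_add' _ _ := ContDiffHolderFunction.ext fun _ => rfl
  map_smul' _ _ := ContDiffHolderFunction.ext fun _ => rfl

variable [CompleteSpace F]

/-- **The inclusion of Hölder levels `C^{k',r}_b(E, F) →L[ℝ] C^{k,r}_b(E, F)`** (`k ≤ k'`, `r ≤ 1`;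
bounded by the closed graph theorem, its point evaluations being continuous). Extension of
`Literature.Analysis.FunctionSpaces.ContDiffHolderFunction`, absolute name. [folklore] -/
def _root_.Literature.Analysis.FunctionSpaces.ContDiffHolderFunction.inclLE (hr : r ≤ 1)
    (h : k ≤ k') : ContDiffHolderFunction E F k' r →L[ℝ] ContDiffHolderFunction E F k r :=
  ContDiffHolderFunction.clmOfContinuousEval (ContDiffHolderFunction.inclLEₗ hr h) fun x =>
    (ContDiffHolderFunction.evalCLM (E := E) (F := F) (k := k') (r := r) x).continuous

/-- Pointwise: `inclLE hr h u x = u x`. [folklore] -/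
@[simp]
theorem _root_.Literature.Analysis.FunctionSpaces.ContDiffHolderFunction.inclLE_apply (hr : r ≤ 1)
    (h : k ≤ k') (u : ContDiffHolderFunction E F k' r) (x : E) :
    ContDiffHolderFunction.inclLE hr h u x = u x := rfl

/-- The underlying function of `inclLE hr h u` is that of `u`. [folklore] -/
@[simp]
theorem _root_.Literature.Analysis.FunctionSpaces.ContDiffHolderFunction.coe_inclLE (hr : r ≤ 1)
    (h : k ≤ k') (u : ContDiffHolderFunction E F k' r) :
    ((ContDiffHolderFunction.inclLE hr h u : ContDiffHolderFunction E F k r) : E → F) = u := rfl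

/-- The inclusion of Hölder levels is injective. [folklore] -/
theorem _root_.Literature.Analysis.FunctionSpaces.ContDiffHolderFunction.inclLE_injective
    (hr : r ≤ 1) (h : k ≤ k') :
    Injective (ContDiffHolderFunction.inclLE (E := E) (F := F) hr h) := fun u v huv =>
  ContDiffHolderFunction.ext fun x => by
    rw [← ContDiffHolderFunction.inclLE_apply hr h u x, huv, ContDiffHolderFunction.inclLE_apply]

/-- The inclusion of a level into itself is the identity. [folklore] -/
@[simp]
theorem _root_.Literature.Analysis.FunctionSpaces.ContDiffHolderFunction.inclLE_refl (hr : r ≤ 1)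
    (u : ContDiffHolderFunction E F k r) : ContDiffHolderFunction.inclLE hr le_rfl u = u :=
  ContDiffHolderFunction.ext fun _ => rfl

/-- Transitivity of the inclusions: `k ≤ k' ≤ k''`. [folklore] -/
@[simp]
theorem _root_.Literature.Analysis.FunctionSpaces.ContDiffHolderFunction.inclLE_inclLE (hr : r ≤ 1)
    (h₁ : k ≤ k') (h₂ : k' ≤ k'') (u : ContDiffHolderFunction E F k'' r) :
    ContDiffHolderFunction.inclLE hr h₁ (ContDiffHolderFunction.inclLE hr h₂ u) =
      ContDiffHolderFunction.inclLE hr (h₁.trans h₂) u :=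
  ContDiffHolderFunction.ext fun _ => rfl

/-- For `k' = k + 1` the inclusion is the order reduction `inclCLM` of
`ContDiffHolderDiffOperator.lean`. [folklore] -/
theorem _root_.Literature.Analysis.FunctionSpaces.ContDiffHolderFunction.inclLE_eq_inclCLM
    (hr : r ≤ 1) (u : ContDiffHolderFunction E F (k + 1) r) :
    ContDiffHolderFunction.inclLE hr k.le_succ u = ContDiffHolderFunction.inclCLM hr u :=
  ContDiffHolderFunction.ext fun _ => rfl

end Holder

/-! ### Level inclusions of the section spaces `𝓗^{k,r}_τ` -/

variable {F : Type} [NormedAddCommGroup F] [NormedSpace ℂ F] [CompleteSpace F] {τ : ℂ → ℂ}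
  {k k' k'' : ℕ} {r : ℝ≥0}

/-- The piece relations do not see the level: a pair of included pieces is a member of
`𝓗^{k,r}_τ` iff the pair is a member of `𝓗^{k',r}_τ`. [folklore] -/
theorem prodMap_inclLE_mem_iff (hr : r ≤ 1) (h : k ≤ k')
    {p : ContDiffHolderFunction ℂ F k' r × ContDiffHolderFunction ℂ F k' r} :
    Prod.map (ContDiffHolderFunction.inclLE hr h) (ContDiffHolderFunction.inclLE hr h) p ∈
        holderSections F τ k r ↔ p ∈ holderSections F τ k' r :=
  Iff.rfl

/-- **The inclusion of section spaces `𝓗^{k',r}_τ →L[ℝ] 𝓗^{k,r}_τ`** (`k ≤ k'`, `r ≤ 1`): the pair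
of level inclusions of the two pieces (the piece relations are conditions on the underlying
functions only). [folklore] -/
def inclLE (hr : r ≤ 1) (h : k ≤ k') : holderSections F τ k' r →L[ℝ] holderSections F τ k r :=
  (((ContDiffHolderFunction.inclLE hr h).prodMap (ContDiffHolderFunction.inclLE hr h)).comp
    (holderSections F τ k' r).subtypeL).codRestrict (holderSections F τ k r) fun p => by
      obtain ⟨hp1, hp2⟩ := p.2
      exact ⟨fun z hz => hp1 z hz, fun w hw => hp2 w hw⟩

/-- The pieces of `inclLE hr h p` are the included pieces of `p`. [folklore] -/
theorem coe_inclLE (hr : r ≤ 1) (h : k ≤ k') (p : holderSections F τ k' r) :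
    ((inclLE hr h p : holderSections F τ k r) :
        ContDiffHolderFunction ℂ F k r × ContDiffHolderFunction ℂ F k r) =
      Prod.map (ContDiffHolderFunction.inclLE hr h) (ContDiffHolderFunction.inclLE hr h)
        (p : ContDiffHolderFunction ℂ F k' r × ContDiffHolderFunction ℂ F k' r) := rfl

/-- The inclusion does not change the first piece. [folklore] -/
@[simp]
theorem inclLE_fst_apply (hr : r ≤ 1) (h : k ≤ k') (p : holderSections F τ k' r) (z : ℂ) :
    ((inclLE hr h p : holderSections F τ k r) :
        ContDiffHolderFunction ℂ F k r × ContDiffHolderFunction ℂ F k r).1 z =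
      (p : ContDiffHolderFunction ℂ F k' r × ContDiffHolderFunction ℂ F k' r).1 z := rfl

/-- The inclusion does not change the second piece. [folklore] -/
@[simp]
theorem inclLE_snd_apply (hr : r ≤ 1) (h : k ≤ k') (p : holderSections F τ k' r) (w : ℂ) :
    ((inclLE hr h p : holderSections F τ k r) :
        ContDiffHolderFunction ℂ F k r × ContDiffHolderFunction ℂ F k r).2 w =
      (p : ContDiffHolderFunction ℂ F k' r × ContDiffHolderFunction ℂ F k' r).2 w := rfl

/-- The underlying function of the first piece is unchanged. [folklore] -/
theorem coe_inclLE_fst (hr : r ≤ 1) (h : k ≤ k') (p : holderSections F τ k' r) :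
    (((inclLE hr h p : holderSections F τ k r) :
        ContDiffHolderFunction ℂ F k r × ContDiffHolderFunction ℂ F k r).1 : ℂ → F) =
      (p : ContDiffHolderFunction ℂ F k' r × ContDiffHolderFunction ℂ F k' r).1 := rfl

/-- The underlying function of the second piece is unchanged. [folklore] -/
theorem coe_inclLE_snd (hr : r ≤ 1) (h : k ≤ k') (p : holderSections F τ k' r) :
    (((inclLE hr h p : holderSections F τ k r) :
        ContDiffHolderFunction ℂ F k r × ContDiffHolderFunction ℂ F k r).2 : ℂ → F) =
      (p : ContDiffHolderFunction ℂ F k' r × ContDiffHolderFunction ℂ F k' r).2 := rfl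

/-- **The inclusion does not change the `z`-representative.** [folklore] -/
theorem sec₀_inclLE (hr : r ≤ 1) (h : k ≤ k') (p : holderSections F τ k' r) :
    sec₀ τ ((inclLE hr h p : holderSections F τ k r) :
        ContDiffHolderFunction ℂ F k r × ContDiffHolderFunction ℂ F k r) =
      sec₀ τ (p : ContDiffHolderFunction ℂ F k' r × ContDiffHolderFunction ℂ F k' r) := rfl

/-- **The inclusion does not change the `w`-representative.** [folklore] -/
theorem sec₁_inclLE (hr : r ≤ 1) (h : k ≤ k') (p : holderSections F τ k' r) :
    sec₁ τ ((inclLE hr h p : holderSections F τ k r) :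
        ContDiffHolderFunction ℂ F k r × ContDiffHolderFunction ℂ F k r) =
      sec₁ τ (p : ContDiffHolderFunction ℂ F k' r × ContDiffHolderFunction ℂ F k' r) := rfl

/-- The inclusion of section spaces is injective. [folklore] -/
theorem inclLE_injective (hr : r ≤ 1) (h : k ≤ k') :
    Injective (inclLE (F := F) (τ := τ) hr h) := by
  intro p q hpq
  have h' := congrArg (fun u : holderSections F τ k r =>
    (u : ContDiffHolderFunction ℂ F k r × ContDiffHolderFunction ℂ F k r)) hpq
  simp only [coe_inclLE] at h'
  exact Subtype.ext (Prod.ext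
    (ContDiffHolderFunction.inclLE_injective hr h (congrArg Prod.fst h'))
    (ContDiffHolderFunction.inclLE_injective hr h (congrArg Prod.snd h')))

/-- The inclusion of a level into itself is the identity. [folklore] -/
@[simp]
theorem inclLE_refl (hr : r ≤ 1) (p : holderSections F τ k r) : inclLE hr le_rfl p = p :=
  Subtype.ext (Prod.ext (ContDiffHolderFunction.ext fun _ => rfl)
    (ContDiffHolderFunction.ext fun _ => rfl))

/-- Transitivity of the inclusions of section spaces. [folklore] -/
@[simp]
theorem inclLE_inclLE (hr : r ≤ 1) (h₁ : k ≤ k') (h₂ : k' ≤ k'') (p : holderSections F τ k'' r) :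
    inclLE hr h₁ (inclLE hr h₂ p) = inclLE hr (h₁.trans h₂) p :=
  Subtype.ext (Prod.ext (ContDiffHolderFunction.ext fun _ => rfl)
    (ContDiffHolderFunction.ext fun _ => rfl))

/-- For `k' = k + 1` the inclusion is `RiemannSphere.inclCLM`. [folklore] -/
theorem inclLE_eq_inclCLM (hr : r ≤ 1) (p : holderSections F τ (k + 1) r) :
    inclLE hr k.le_succ p = inclCLM hr p :=
  Subtype.ext (Prod.ext (ContDiffHolderFunction.ext fun _ => rfl)
    (ContDiffHolderFunction.ext fun _ => rfl))

/-- **Level lift**: a member of `𝓗^{k,r}_τ` whose two pieces are in `C^{k',r}_b(ℂ, F)` is the image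
under `inclLE` of a member of `𝓗^{k',r}_τ` (unique by `inclLE_injective`, with the same chart
representatives by `sec₀_inclLE`, `sec₁_inclLE`). [folklore] -/
theorem exists_inclLE_eq_of_memContDiffHolder (hr : r ≤ 1) (h : k ≤ k')
    (p : holderSections F τ k r)
    (h₁ : MemContDiffHolder k' r
      ((p : ContDiffHolderFunction ℂ F k r × ContDiffHolderFunction ℂ F k r).1 : ℂ → F))
    (h₂ : MemContDiffHolder k' r
      ((p : ContDiffHolderFunction ℂ F k r × ContDiffHolderFunction ℂ F k r).2 : ℂ → F)) :
    ∃ q : holderSections F τ k' r, inclLE hr h q = p :=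
  ⟨⟨(⟨_, h₁⟩, ⟨_, h₂⟩), fun z hz => p.2.1 z hz, fun w hw => p.2.2 w hw⟩,
    Subtype.ext (Prod.ext (ContDiffHolderFunction.ext fun _ => rfl)
      (ContDiffHolderFunction.ext fun _ => rfl))⟩

/-- The range of `inclLE` consists exactly of the members whose pieces are `C^{k',r}_b`.
[folklore] -/
theorem mem_range_inclLE_iff (hr : r ≤ 1) (h : k ≤ k') (p : holderSections F τ k r) :
    p ∈ Set.range (inclLE (F := F) (τ := τ) hr h) ↔
      MemContDiffHolder k' r
          ((p : ContDiffHolderFunction ℂ F k r × ContDiffHolderFunction ℂ F k r).1 : ℂ → F) ∧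
        MemContDiffHolder k' r
          ((p : ContDiffHolderFunction ℂ F k r × ContDiffHolderFunction ℂ F k r).2 : ℂ → F) := by
  constructor
  · rintro ⟨q, rfl⟩
    exact ⟨(q : ContDiffHolderFunction ℂ F k' r × ContDiffHolderFunction ℂ F k' r).1.memContDiffHolder,
      (q : ContDiffHolderFunction ℂ F k' r × ContDiffHolderFunction ℂ F k' r).2.memContDiffHolder⟩
  · rintro ⟨h₁, h₂⟩
    exact exists_inclLE_eq_of_memContDiffHolder hr h p h₁ h₂

/-- Evaluation of the `z`-piece commutes with the inclusion. [folklore] -/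
@[simp]
theorem eval₀CLM_inclLE (hr : r ≤ 1) (h : k ≤ k') (z₀ : ℂ) (p : holderSections F τ k' r) :
    eval₀CLM (F := F) τ k r z₀ (inclLE hr h p) = eval₀CLM (F := F) τ k' r z₀ p := rfl

/-- Evaluation of the `w`-piece commutes with the inclusion. [folklore] -/
@[simp]
theorem eval₁CLM_inclLE (hr : r ≤ 1) (h : k ≤ k') (w₀ : ℂ) (p : holderSections F τ k' r) :
    eval₁CLM (F := F) τ k r w₀ (inclLE hr h p) = eval₁CLM (F := F) τ k' r w₀ p := rfl

/-- **The cut-off `z`-representative commutes with the inclusions.** [folklore] -/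
theorem cutSec₀CLM_inclLE (hτ : ∀ w, w ≠ 0 → τ w ≠ 0) (hτs : ContDiffOn ℝ ∞ τ {w | w ≠ 0})
    (hr : r ≤ 1) (h : k ≤ k') (p : holderSections F τ k' r) :
    cutSec₀CLM hτ hτs hr (inclLE hr h p) =
      ContDiffHolderFunction.inclLE hr h (cutSec₀CLM hτ hτs hr p) :=
  ContDiffHolderFunction.ext fun _ => rfl

/-- **The cut-off `w`-representative commutes with the inclusions.** [folklore] -/
theorem cutSec₁CLM_inclLE (hτs : ContDiffOn ℝ ∞ τ {w | w ≠ 0}) (hr : r ≤ 1) (h : k ≤ k')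
    (p : holderSections F τ k' r) :
    cutSec₁CLM hτs hr (inclLE hr h p) =
      ContDiffHolderFunction.inclLE hr h (cutSec₁CLM hτs hr p) :=
  ContDiffHolderFunction.ext fun _ => rfl

/-- The three-point slice commutes with the inclusion (`τ w = -w²`). [folklore] -/
@[simp]
theorem slice₃_inclLE (hr : r ≤ 1) (h : k ≤ k')
    (ξ : holderSections F (fun w : ℂ => -w ^ 2) k' r) :
    slice₃ k r (inclLE hr h ξ) = slice₃ k' r ξ := rfl

end RiemannSphere

end Literature.Analysis.Complex

end
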